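import Mathlib

/-!
# Tower graft line — skew-block families: a BLOCK KERNEL LEMMA (linear algebra for chains of scaled rich blocks)

Helper (pure linear algebra, no pencil) for `…TowerGraftSkewBlockRichCopies.lean` (line `Cruxes/WeakLifting/Lines/tower_graft.lean`, crux
`WeakLifting` = stmt-ValiantsHypothesis-19561; S4b calibration; crit-6 kill-shape #38⁺).  NO stub is claimed; nothing here is specific to pencils.

* `mulVec_injective_submatrix_of_kernel` — if every solution of `M x = 0` with `x i₀ = 0` vanishes, then `M` with column `i₀` deleted
  (columns re-indexed by any injection avoiding `i₀`, rows by any surjection) has injective `mulVec` — the form in which p689545's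
  `skewBlock_phantoms_square` consumes «`B″(ρ)` has full column rank», robust under `Matrix.reindex`.
* `blockDiagonal_mulVec_apply` — `mulVec` of `Matrix.blockDiagonal`, blockwise.
* `block_kernel` — for `M = fromBlocks R₀ C 0 (blockDiagonal R)` on `Fin 3 ⊕ (Fin 3 × o)` with the coupling `C` feeding coordinate `0` of
  every diagonal block into row `2` of `R₀`: if all blocks but a designated one are non-singular, the designated block is injective on
  `{u | u 0 = 0}`, and (when the designated block is not `R₀`) `R₀ u + c·e₂ = 0, u 0 = 0 ⇒ u = 0 ∧ c = 0`, then `M x = 0 ∧ x (inl 0) = 0 ⇒ x = 0`.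

HONEST FRAMING: elementary linear algebra; nothing on S4/S4b/S5/S5ᴸ, TowerB, `WeakLifting`, Conjecture B, `MatrixDescartes` (18050) or `VP ≠ VNP`.
Def-free.  Seat: prover val-sym-lift-p2 g20, `--supports stmt-ValiantsHypothesis-19561`.
-/

-- `Summit.ValiantsHypothesis.ValiantsHypothesis.…` repeats a component by the D-0017 layout
-- (single-conjunct summit), which the `dupNamespace` linter flags; the name is mandated.
set_option linter.dupNamespace false

namespace Summit.ValiantsHypothesis.ValiantsHypothesis.Theorems.KPlusLogSqLaw.TowerGraft

open Matrix
open scoped BigOperators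

section GenericLA

variable {ι : Type*} [Fintype ι]

/-- if every solution of `M x = 0` with `x i₀ = 0` is zero, then `M` with column `i₀` removed (columns re-indexed by any injection `g`
avoiding `i₀`, rows re-indexed by any surjection `σ`) has injective `mulVec`. [folklore] -/
theorem mulVec_injective_submatrix_of_kernel {κ ρ : Type*} [Fintype κ] [DecidableEq κ]
    (M : Matrix ι ι ℝ) (i₀ : ι) (σ : ρ → ι) (hσ : Function.Surjective σ) (g : κ → ι) (hg : Function.Injective g)
    (hgi : ∀ k, g k ≠ i₀) (hker : ∀ x : ι → ℝ, M *ᵥ x = 0 → x i₀ = 0 → x = 0) :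
    Function.Injective (M.submatrix σ g).mulVec := by
  classical
  -- it suffices to show the kernel is trivial
  suffices h0 : ∀ y : κ → ℝ, (M.submatrix σ g) *ᵥ y = 0 → y = 0 by
    intro y₁ y₂ h
    have := h0 (y₁ - y₂) (by rw [Matrix.mulVec_sub, h, sub_self])
    exact sub_eq_zero.mp this
  intro y hy
  -- extend `y` by zero to `ι`
  set x : ι → ℝ := Function.extend g y 0 with hx
  have hxg : ∀ k, x (g k) = y k := fun k => hg.extend_apply _ _ k
  have hx0 : ∀ i, (∀ k, g k ≠ i) → x i = 0 := fun i hi => by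
    rw [hx, Function.extend_apply' _ _ _ (fun ⟨k, hk⟩ => hi k hk)]; rfl
  have hMx : M *ᵥ x = 0 := by
    funext i
    obtain ⟨r, rfl⟩ := hσ i
    have hr := congrFun hy r
    simp only [Matrix.mulVec, dotProduct, Matrix.submatrix_apply, Pi.zero_apply] at hr ⊢
    -- split the sum over `ι` into the range of `g` and the rest (where `x` vanishes)
    have h1 : ∑ j ∈ (Finset.univ.map ⟨g, hg⟩), M (σ r) j * x j = ∑ k, M (σ r) (g k) * x (g k) := by
      rw [Finset.sum_map]; rfl
    have h2 : ∑ j ∈ (Finset.univ.map ⟨g, hg⟩), M (σ r) j * x j = ∑ j, M (σ r) j * x j := by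
      apply Finset.sum_subset (Finset.subset_univ _)
      intro j _ hj
      have : ∀ k, g k ≠ j := fun k hk => hj (Finset.mem_map.mpr ⟨k, Finset.mem_univ _, hk⟩)
      rw [hx0 j this, mul_zero]
    rw [← h2, h1]
    simpa [hxg] using hr
  have hxi : x i₀ = 0 := hx0 i₀ hgi
  have := hker x hMx hxi
  funext k
  rw [← hxg k, this]; rfl

/-- `mulVec` of a block-diagonal matrix, blockwise. [folklore] -/
theorem blockDiagonal_mulVec_apply {o m n : Type*} [Fintype o] [DecidableEq o] [Fintype n] [Fintype m]
    (R : o → Matrix m n ℝ) (v : n × o → ℝ) (i : m) (k : o) :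
    (blockDiagonal R *ᵥ v) (i, k) = (R k *ᵥ fun j => v (j, k)) i := by
  simp only [Matrix.mulVec, dotProduct, Fintype.sum_prod_type, blockDiagonal_apply']
  rw [Finset.sum_comm]
  simp

/-- **block kernel lemma.**  `M = [[R₀, C],[0, diag(R_b)]]` on `Fin 3 ⊕ (Fin 3 × o)`, where the coupling `C` feeds the `0`-th coordinate
of every block into row `2` of block `0`.  If all blocks but one are non-singular, the singular one is injective once its column `0` is removed,
and (when the singular block is not block `0`) the columns `1, 2` of `R₀` together with `e₂` are independent, then every solution of
`M x = 0` with `x (inl 0) = 0` vanishes. [this work] -/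
theorem block_kernel {o : Type*} [Fintype o] [DecidableEq o] (R₀ : Matrix (Fin 3) (Fin 3) ℝ) (R : o → Matrix (Fin 3) (Fin 3) ℝ)
    (a : Option o)
    (hR : ∀ b, a ≠ some b → (R b).det ≠ 0)
    (hR₀ : a ≠ none → ∀ (u : Fin 3 → ℝ) (c : ℝ), u 0 = 0 → R₀ *ᵥ u + Pi.single 2 c = 0 → u = 0 ∧ c = 0)
    (ha : ∀ u : Fin 3 → ℝ, u 0 = 0 → (a.elim R₀ R) *ᵥ u = 0 → u = 0)
    (x : Fin 3 ⊕ (Fin 3 × o) → ℝ)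
    (hx : fromBlocks R₀ (Matrix.of fun (i : Fin 3) (jk : Fin 3 × o) => if i = 2 ∧ jk.1 = 0 then (1 : ℝ) else 0) 0 (blockDiagonal R) *ᵥ x = 0)
    (hx0 : x (Sum.inl 0) = 0) : x = 0 := by
  classical
  rw [fromBlocks_mulVec] at hx
  have hx1 := congrArg (fun f => f ∘ Sum.inl) hx
  have hx2 := congrArg (fun f => f ∘ Sum.inr) hx
  simp only [Sum.elim_comp_inl, Sum.elim_comp_inr, Matrix.zero_mulVec, zero_add, Pi.zero_comp] at hx1 hx2
  have hx2' : ∀ (k : o) (i : Fin 3), (R k *ᵥ fun j => x (Sum.inr (j, k))) i = 0 := by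
    intro k i
    have := congrFun hx2 (i, k)
    rw [blockDiagonal_mulVec_apply] at this
    simpa using this
  -- blocks other than the singular one vanish
  have hvan : ∀ k, a ≠ some k → ∀ j, x (Sum.inr (j, k)) = 0 := by
    intro k hk j
    have h := Matrix.eq_zero_of_mulVec_eq_zero (hR k hk) (v := fun j => x (Sum.inr (j, k))) (funext (hx2' k))
    exact congrFun h j
  -- the coupling term
  have hC : ∀ i : Fin 3, ((Matrix.of fun (i : Fin 3) (jk : Fin 3 × o) => if i = 2 ∧ jk.1 = 0 then (1 : ℝ) else 0) *ᵥ
      (x ∘ Sum.inr)) i = if i = 2 then ∑ k, x (Sum.inr (0, k)) else 0 := by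
    intro i
    simp only [Matrix.mulVec, dotProduct, Matrix.of_apply, Function.comp, Fintype.sum_prod_type]
    by_cases hi : i = 2
    · simp [hi]
    · simp [hi]
  rcases a with _ | b₀
  · -- singular block is block `0`: all other blocks vanish, the coupling sum is zero, and `R₀ u = 0` with `u 0 = 0`
    have hall : ∀ k j, x (Sum.inr (j, k)) = 0 := fun k j => hvan k (by simp) j
    have hu : R₀ *ᵥ (x ∘ Sum.inl) = 0 := by
      funext i
      have := congrFun hx1 i
      simp only [Pi.add_apply, hC, hall, Finset.sum_const_zero, ite_self, add_zero] at this
      exact this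
    have h0 := ha (x ∘ Sum.inl) hx0 (by simpa using hu)
    funext s
    rcases s with i | ⟨j, k⟩
    · exact congrFun h0 i
    · exact hall k j
  · -- singular block is `b₀`
    have hall : ∀ k, k ≠ b₀ → ∀ j, x (Sum.inr (j, k)) = 0 := fun k hk j => hvan k (by simpa [eq_comm] using hk) j
    have hsum : ∑ k, x (Sum.inr (0, k)) = x (Sum.inr (0, b₀)) := by
      rw [Finset.sum_eq_single b₀]
      · intro k _ hk; exact hall k hk 0
      · intro h; exact absurd (Finset.mem_univ _) h
    have hu : R₀ *ᵥ (x ∘ Sum.inl) + Pi.single 2 (x (Sum.inr (0, b₀))) = 0 := by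
      funext i
      have := congrFun hx1 i
      simp only [Pi.add_apply, hC, hsum] at this
      simp only [Pi.add_apply, Pi.single_apply, Pi.zero_apply]
      exact this
    obtain ⟨hu0, hc⟩ := hR₀ (by simp) (x ∘ Sum.inl) _ hx0 hu
    -- now block `b₀`: `R b₀ v = 0` with `v 0 = 0`
    have hv := ha (fun j => x (Sum.inr (j, b₀))) hc (funext (hx2' b₀))
    funext s
    rcases s with i | ⟨j, k⟩
    · exact congrFun hu0 i
    · by_cases hk : k = b₀
      · subst hk; exact congrFun hv j
      · exact hall k hk j

end GenericLA

end Summit.ValiantsHypothesis.ValiantsHypothesis.Theorems.KPlusLogSqLaw.TowerGraft
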